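import Mathlib
import Summits.HodgeConjecture.FermatCycles.HodgeFermatHypUOdd
import Summits.HodgeConjecture.FermatCycles.HodgeFermatD6OneFile
import Summits.HodgeConjecture.FermatCycles.HodgeFermatHypUPlusC
import Summits.HodgeConjecture.FermatCycles.HodgeFermatHypURange3
import Summits.HodgeConjecture.FermatCycles.HodgeFermatHypURange30k
import Summits.HodgeConjecture.FermatCycles.HodgeFermatHypURangeN

/-!
# LEMMA W and THEOREM U at every odd squarefree level / THEOREM U⁺ at EVERY odd level `N ∉ {21, 39}` (`HodgeFermat/TheoremUOdd.lean`, `TheoremUPlus.lean`; HF-G25, HF-G26), then LEMMA S / LEMMA S⁺ unconditionally (`HypUOddFinal.lean`, `HypUPlusFinal.lean`)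

Tree copy of 4 SMALL MODULES of the sibling cell's standalone package `run/shared/lean/pub/pub-hodgefermat/lean/HodgeFermat/`,
concatenated IN DEPENDENCY ORDER in one tree file (one gate round-trip instead of 4; the hub's import-level build backlog was ≈ 50 min
per level when this file was assembled) — each module's body byte-identical to its source lines, its own `namespace … end` block kept:
  1. `HodgeFermat/TheoremUOdd.lean` (84 lines, sha256 `bcba74ff9f302802…`), whole module, source lines 26–84 (all: `HypWOdd`, `ThmUOdd`, `hypWOdd_of`, `thmUOdd_of`) — pub-hodgefermat `CERT.md` l.906, GATE HF-G25;
  2. `HodgeFermat/TheoremUPlus.lean` (118 lines, sha256 `ffc1d7e0b6e30a07…`), whole module, source lines 27–118 (all: `HypWPlus`, `ThmUPlus`, `hypWPlus_of`, `thmUPlus_of`, `hypWPlus_of_ranges`, the generation-25 corollaries) — pub-hodgefermat `CERT.md` l.909, GATE HF-G26;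
  3. `HodgeFermat/HypUOddFinal.lean` (33 lines, sha256 `788b6710729a1d22…`), whole module, source lines 22–33 (all: `good3`, `goodOdd : GoodOdd` — LEMMA S unconditionally) — pub-hodgefermat `CERT.md` l.906, GATE HF-G25;
  4. `HodgeFermat/HypUPlusFinal.lean` (23 lines, sha256 `3773c8760e9ca23a…`), whole module, source lines 16–23 (all: `goodOddP : GoodOddP` — LEMMA S⁺ unconditionally) — pub-hodgefermat `CERT.md` l.909, GATE HF-G26;
Filed by cell `pub-hfermat`, seat prover-1 gen-3, on the COORDINATOR KEEPER RULING of 2026-08-25 (gem sweep H1: take the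
off-gate kernel theorem `thmFstar` through the gate) — here THEOREM F* of `tables/DPRIME-THEOREM.md` §9 IN FULL, i.e.
PROPOSITION D′(3N) and the descent (`HodgeFermat/PropDPrimeNFinal.lean`, GATE HF-G34), the last off-gate form of THEOREM F*
(its first two forms, `DecodingFinal.thmFstar` = F* at the prime levels and `ThmFstarNFinal.thmFstar` = F*(3N), landed on
2026-08-25 as `HodgeFermatThmFstar.lean` / `HodgeFermatThmFstarN.lean`, seats prover-1 gen-0 / gen-2); these modules are links of
the import closure of `PropDPrimeNFinal.propDprime` (the sibling's KR-free chain: THEOREM L, COROLLARY M, THEOREM D6,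
THEOREM U⁺, THEOREM KR6, THEOREM Z3U) on top of those landed chains.  Each source module is the sibling's module of record named in item 1–4 above; declarations are copied VERBATIM.
Deviations from the source modules, exhaustively: the `import` lines (tree modules `Summits.HodgeConjecture.FermatCycles.HodgeFermat*`
instead of `HodgeFermat.*`, hoisted to the top; the source `import` lines between the concatenated modules are dropped); this docstring
(replacing the modules' docstrings, all quoted below); none at file level beyond the concatenation itself; per module: (`import …HodgeFermatD6OneFile` stands for the sources' `import HodgeFermat.HurwitzZero` / `HodgeFermat.D6OneFile`, §6 of `HurwitzZero` being in that tree file)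
  — module 1 (`TheoremUOdd.lean`): one-line docstrings added (gate lint) to `hypWOdd_of`.
  — module 2 (`TheoremUPlus.lean`): one-line docstrings added (gate lint) to `hypWPlus_of`, `hypWPlus_of_ranges`, `hypWOdd_of_hypWPlus`.
  — module 3 (`HypUOddFinal.lean`): DEDUP (pre-empting the gate's `dedup.landed`): the source's `theorem hypU : HypU` (l.23–24; generation 24's HYPOTHESIS U reassembled without the analytic chain) has exactly the statement of `HodgeFermat.KRFree.OneFile.hypU` (`HodgeFermatD6OneFile.lean`) and is DELETED, the name kept as an alias by the added line `export HodgeFermat.KRFree.OneFile (hypU)` (extra import).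
  — module 4 (`HypUPlusFinal.lean`): none besides these.
Every other line — in particular every declaration's statement and proof — is byte-identical to its source.
HONEST FRAMING: explicit algebraic cycles for specific Hodge classes on Fermat/Delsarte varieties; residual open instances
listed; no claim on general Hodge.  (This file is arithmetic of CM types / finite combinatorics / analytic number theory
of the sibling's KR-free programme; it claims nothing about cycles.)

(1) The docstring of `HodgeFermat/TheoremUOdd.lean` (l.7–24), verbatim:

## LEMMA W and THEOREM U at every odd squarefree level `N ∉ {21, 39}` (HF-G25)

Koblitz–Rohrlich's Remark 2 in full: at a squarefree ODD level `m ∉ {21, 39}` two triples all of whose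
entries are units and which have the same CM type share an entry (`thmUOdd : ThmUOdd`; with PROPOSITION
C⁻ they are then equal) — generations 22–24 had this at the levels prime to `6` only (`ThmU`), because
LEMMA S was certified there only.  The chain is the kernel's own, applied level by level:
`GoodOdd` (LEMMA S, `HypUOdd.lean`) ⟹ `12 · #bad odd characters < φ(N)` (`bad_lt_of_good`, the
per-level form of `HypBReduction.hypB_of_H0_U`, `HypH0` discharged by `HurwitzZero.hypH0`) ⟹ LEMMA W
(`LemmaWFourier.lemmaW_of_badCount`) ⟹ THEOREM U (`TheoremU.allunit_share`).  At `N = 21, 39` THEOREM U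
is false (`tables/SEMI-THEOREM.md` §2: `(1,4,16) ∼ (2,8,11)` at `21`, the class of `(1,16,22)` at `39`).

THIS module is the LIGHT half: everything as a function of `GoodOdd` (`hypWOdd_of`, `thmUOdd_of`) and of the
two certified range statements (`thmUOdd_of_ranges : URange 2 30001 → URange3 3 100001 → ThmUOdd`), hub-checked
with the entire analytic chain in one quick file (`check/ThmUOddLight_standalone.lean`); `TheoremUOddFinal.lean`
supplies the ranges (`thmUOdd : ThmUOdd`, `hypWOdd`, `thmU'`), and everything together is
`check/ThmUOdd_standalone.lean`.

(2) The docstring of `HodgeFermat/TheoremUPlus.lean` (l.7–25), verbatim: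

## LEMMA W and THEOREM U⁺ at EVERY odd level `N ∉ {21, 39}` — squarefree or not (HF-G26)

The analytic chain of generations 22–25 at a general level.  `HypBReduction` already counts the characters of
`K_p = subgroupOfPrimitiveMapToOne ℂ N p` through the general cofactor `n_p = N / p ^ v_p(N)`
(`card_K_mul_orderOf`, `even_of_mem_K`); squarefreeness was used only to rewrite `n_p = N / p` so as to meet
`tau`.  Reading `τ` modulo `n_p` instead (`HypUPlus.tauP`) removes the hypothesis:
`two_mul_card_oddK_leP : 2 · #(odd characters of K_p) ≤ τ⁺(N, p)` at every level, hence
`bad_lt_of_goodP : 1 < N → GoodP N → 12 · #bad(N) < φ(N)` (HYPOTHESIS H0 discharged by `HurwitzZero.hypH0`),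
LEMMA W (`LemmaWFourier.lemmaW_of_badCount`) and THEOREM U (`TheoremU.allunit_share`, which never assumed
squarefreeness) at every odd level `N ∉ {21, 39}` where LEMMA S⁺ holds — i.e. all of them (`HypUPlus.GoodOddP`).

THIS module is the LIGHT half: `hypWPlus_of`, `thmUPlus_of : GoodOddP → ThmUPlus` and
`thmUPlus_of_ranges : URange 2 30001 → URange3 3 100001 → NRange 1 100001 → ThmUPlus`, hub-checked with the
entire analytic chain in one quick file (`check/ThmUPlusLight_standalone.lean`); `TheoremUPlusFinal.lean` supplies
the three ranges (`thmUPlus : ThmUPlus`, `hypWPlus : HypWPlus`).  The generation-25 statements `ThmUOdd`, `HypWOdd`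
are the special case `Squarefree N` (`thmUOdd_of_thmUPlus`, `hypWOdd_of_hypWPlus`).
At `N = 21, 39` THEOREM U is false (`tables/SEMI-THEOREM.md` §2); paper §1 (xvi), `tables/NSF-COINCIDENCES.md` §5.

(3) The docstring of `HodgeFermat/HypUOddFinal.lean` (l.8–15), verbatim:

## LEMMA S at every odd squarefree level — unconditional (HF-G25)

`goodOdd : GoodOdd`: the light assembly `HypUOdd.goodOdd_of_ranges` applied to the two kernel walks
`HypURange30k.uRange_2_30001 : URange 2 30001` (generation 24: every squarefree `N ≤ 3·10⁴` prime to `6`)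
and `HypURange3.uRange3_3_100001 : URange3 3 100001` (generation 25: every squarefree `N < 100001` with
`3 ∣ N`, `N ∉ {21, 39}`).  Elementary; hub-checked with everything it imports as `check/UOdd_standalone.lean`.

(4) The docstring of `HodgeFermat/HypUPlusFinal.lean` (l.7–14), verbatim:

## LEMMA S⁺ at every odd level — unconditional (HF-G26)

`goodOddP : GoodOddP`: the light assembly `HypUPlus.goodOddP_of` applied to LEMMA S (`HypUOddFinal.goodOdd`,
generations 24–25: the two squarefree range walks) and the walk over the non-squarefree odd levels
`HypURangeN.nRange_1_100001`.  Elementary.  Hub records: `check/HypURangeN_standalone.lean` (the new walk) and the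
link check `check/ThmUPlusLink_standalone.lean`.
-/

/-! ## (1/4) `HodgeFermat/TheoremUOdd.lean` — source lines 26–84 -/

set_option autoImplicit false

namespace HodgeFermat.KRFree.HypUOdd

open Finset HodgeFermat.KRFree.HypBReduction HodgeFermat.KRFree.HypUCert HodgeFermat.KRFree.LemmaN
open HodgeFermat.KRFree.LemmaWFourier HodgeFermat.KRFree.TheoremU HodgeFermat.KRFree.TheoremD6
open HodgeFermat.KRFree.HurwitzZero

/-- per level: LEMMA S at `N` gives `12 · #(bad odd characters mod N) < φ(N)`. -/
theorem bad_lt_of_good (N : ℕ) (h1 : 1 < N) (hsq : Squarefree N) (hg : Good N) :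
    12 * badCount N < N.totient := by
  haveI : NeZero N := ⟨by omega⟩
  rw [badCount_eq]
  have hcard : (badSet N).card ≤ ∑ p ∈ N.primeFactors, (oddK N p).card :=
    (Finset.card_le_card (badSet_subset hypH0 N)).trans Finset.card_biUnion_le
  have hsum : 2 * ∑ p ∈ N.primeFactors, (oddK N p).card ≤ ∑ p ∈ N.primeFactors, tau N p := by
    rw [Finset.mul_sum]
    exact Finset.sum_le_sum (fun p hp => two_mul_card_oddK_le N p hsq hp)
  have hg' : 6 * ∑ p ∈ N.primeFactors, tau N p < N.totient := hg
  omega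

/-- LEMMA W at every odd squarefree level `N > 1`, `N ∉ {21, 39}`. -/
def HypWOdd : Prop := ∀ N, 1 < N → Squarefree N → ¬ 2 ∣ N → N ≠ 21 → N ≠ 39 → LemmaW N

/-- LEMMA W at every odd squarefree level `∉ {21, 39}` from `GoodOdd` -/
theorem hypWOdd_of (hg : GoodOdd) : HypWOdd := fun N h1 hsq h2 h21 h39 =>
  lemmaW_of_badCount h1 (bad_lt_of_good N h1 hsq (hg N h1 hsq h2 h21 h39))

/-- THEOREM U at every squarefree odd level other than `21, 39` (Koblitz–Rohrlich, Remark 2): two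
all-unit triples with the same CM type share an entry mod `N`. -/
def ThmUOdd : Prop :=
  ∀ N a b c a' b' c' : ℕ, Squarefree N → ¬ 2 ∣ N → N ≠ 21 → N ≠ 39 →
    N ∣ a + b + c → N ∣ a' + b' + c' →
    Nat.Coprime a N → Nat.Coprime b N → Nat.Coprime c N →
    Nat.Coprime a' N → Nat.Coprime b' N → Nat.Coprime c' N →
    SameType N (a, b, c) (a', b', c') → (a ≡ a' [MOD N] ∨ a ≡ b' [MOD N] ∨ a ≡ c' [MOD N])

/-- **THEOREM U** at every squarefree odd level `N ∉ {21, 39}`, from LEMMA S (`GoodOdd`). -/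
theorem thmUOdd_of (hg : GoodOdd) : ThmUOdd := by
  intro N a b c a' b' c' hsq h2 h21 h39 hs hs' ha hb hc ha' hb' hc' hT
  rcases Nat.lt_or_ge 1 N with h1N | hN1
  · exact allunit_share N a b c a' b' c' (hypWOdd_of hg N h1N hsq h2 h21 h39) h1N h2 hs hs' ha hb hc
      ha' hb' hc' hT
  · have hN0 : N ≠ 0 := fun h => by subst h; exact not_squarefree_zero hsq
    obtain rfl : N = 1 := by omega
    exact Or.inl (Nat.modEq_one)

/-- THEOREM U at every squarefree odd level `N ∉ {21, 39}` as a function of the two certified range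
statements (`HypURange30k.uRange_2_30001`, `HypURange3.uRange3_3_100001`); the analytic chain and the
light half of LEMMA S are inside.  Composed in `TheoremUOddFinal.thmUOdd`. -/
theorem thmUOdd_of_ranges (h1 : URange 2 30001) (h3r : URange3 3 100001) : ThmUOdd :=
  thmUOdd_of (goodOdd_of_ranges h1 h3r)

/-- the generation-22 statement `ThmU` (levels prime to `6`) is the special case `3 ∤ N`. -/
theorem thmU_of_thmUOdd (h : ThmUOdd) : ThmU :=
  fun N a b c a' b' c' hsq h2 h3 =>
    h N a b c a' b' c' hsq h2 (fun e => h3 (by rw [e]; norm_num)) (fun e => h3 (by rw [e]; norm_num))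


end HodgeFermat.KRFree.HypUOdd

/-! ## (2/4) `HodgeFermat/TheoremUPlus.lean` — source lines 27–118 -/

set_option autoImplicit false

namespace HodgeFermat.KRFree.HypUPlus

open Finset HodgeFermat.KRFree.HypBReduction HodgeFermat.KRFree.HypUCert HodgeFermat.KRFree.LemmaN
open HodgeFermat.KRFree.LemmaWFourier HodgeFermat.KRFree.TheoremU HodgeFermat.KRFree.TheoremD6
open HodgeFermat.KRFree.HurwitzZero HodgeFermat.KRFree.HypUOdd DirichletCharacter

open Classical in
/-- `2 · #(odd characters of K_p) ≤ τ⁺(N, p)` at EVERY level `N` (no squarefree hypothesis):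
`#K_p · ord_{n_p}(p) = φ(n_p)` and at most half of `K_p` is odd, none if `-1 ∈ ⟨p⟩ mod n_p`. -/
theorem two_mul_card_oddK_leP (N p : ℕ) [NeZero N] (hp : p ∈ N.primeFactors) :
    2 * (oddK N p).card ≤ tauP N p := by
  have hpp : p.Prime := Nat.prime_of_mem_primeFactors hp
  haveI := Fact.mk hpp
  have hcop : p.Coprime (N / p ^ N.factorization p) := Nat.coprime_ordCompl hpp (NeZero.ne N)
  haveI : NeZero (N / p ^ N.factorization p) := ⟨(Nat.ordCompl_pos p (NeZero.ne N)).ne'⟩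
  rw [oddK, dif_pos hpp, tauP, npart, tauAt]
  split_ifs with hneg
  · have hempty : Finset.univ.filter
        (fun χ => χ ∈ @subgroupOfPrimitiveMapToOne ℂ _ N _ p (Fact.mk hpp) ∧ χ.Odd) = ∅ := by
      rw [Finset.filter_eq_empty_iff]
      intro χ _ hχ
      exact DirichletCharacter.not_even_and_odd χ ⟨even_of_mem_K N p hneg hχ.1, hχ.2⟩
    rw [hempty, Finset.card_empty]
  · have hK := card_K_mul_orderOf N p
    have hle := two_mul_card_odd_le (@subgroupOfPrimitiveMapToOne ℂ _ N _ p (Fact.mk hpp))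
    have hpos : 0 < orderOf ((p : ℕ) : ZMod (N / p ^ N.factorization p)) := by
      rw [← ZMod.coe_unitOfCoprime p hcop, orderOf_units]
      exact orderOf_pos _
    calc 2 * (Finset.univ.filter
          (fun χ => χ ∈ @subgroupOfPrimitiveMapToOne ℂ _ N _ p (Fact.mk hpp) ∧ χ.Odd)).card
        ≤ Nat.card (@subgroupOfPrimitiveMapToOne ℂ _ N _ p (Fact.mk hpp)) := hle
      _ = (N / p ^ N.factorization p).totient /
            orderOf ((p : ℕ) : ZMod (N / p ^ N.factorization p)) := by
        rw [← hK, Nat.mul_div_cancel _ hpos]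

/-- per level: LEMMA S⁺ at `N` gives `12 · #(bad odd characters mod N) < φ(N)` — every `N > 1`. -/
theorem bad_lt_of_goodP (N : ℕ) (h1 : 1 < N) (hg : GoodP N) : 12 * badCount N < N.totient := by
  haveI : NeZero N := ⟨by omega⟩
  rw [badCount_eq]
  have hcard : (badSet N).card ≤ ∑ p ∈ N.primeFactors, (oddK N p).card :=
    (Finset.card_le_card (badSet_subset hypH0 N)).trans Finset.card_biUnion_le
  have hsum : 2 * ∑ p ∈ N.primeFactors, (oddK N p).card ≤ ∑ p ∈ N.primeFactors, tauP N p := by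
    rw [Finset.mul_sum]
    exact Finset.sum_le_sum (fun p hp => two_mul_card_oddK_leP N p hp)
  have hg' : 6 * ∑ p ∈ N.primeFactors, tauP N p < N.totient := hg
  omega

/-- LEMMA W at every odd level `N > 1`, `N ∉ {21, 39}`. -/
def HypWPlus : Prop := ∀ N, 1 < N → ¬ 2 ∣ N → N ≠ 21 → N ≠ 39 → LemmaW N

/-- LEMMA W at every odd level `∉ {21, 39}` from `GoodOddP` -/
theorem hypWPlus_of (hg : GoodOddP) : HypWPlus := fun N h1 h2 h21 h39 =>
  lemmaW_of_badCount h1 (bad_lt_of_goodP N h1 (hg N h1 h2 h21 h39))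

/-- **THEOREM U⁺**: at every ODD level `N ∉ {21, 39}` — squarefree or not — two all-unit triples with the same
CM type share an entry mod `N`. -/
def ThmUPlus : Prop :=
  ∀ N a b c a' b' c' : ℕ, ¬ 2 ∣ N → N ≠ 21 → N ≠ 39 →
    N ∣ a + b + c → N ∣ a' + b' + c' →
    Nat.Coprime a N → Nat.Coprime b N → Nat.Coprime c N →
    Nat.Coprime a' N → Nat.Coprime b' N → Nat.Coprime c' N →
    SameType N (a, b, c) (a', b', c') → (a ≡ a' [MOD N] ∨ a ≡ b' [MOD N] ∨ a ≡ c' [MOD N])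

/-- THEOREM U⁺ from LEMMA S⁺ (`GoodOddP`). -/
theorem thmUPlus_of (hg : GoodOddP) : ThmUPlus := by
  intro N a b c a' b' c' h2 h21 h39 hs hs' ha hb hc ha' hb' hc' hT
  rcases Nat.lt_or_ge 1 N with h1N | hN1
  · exact allunit_share N a b c a' b' c' (hypWPlus_of hg N h1N h2 h21 h39) h1N h2 hs hs' ha hb hc
      ha' hb' hc' hT
  · have hN0 : N ≠ 0 := fun h => h2 (by rw [h]; exact dvd_zero 2)
    obtain rfl : N = 1 := by omega
    exact Or.inl (Nat.modEq_one)

/-- THEOREM U⁺ as a function of the THREE certified range statements (`HypURange30k.uRange_2_30001`,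
`HypURange3.uRange3_3_100001`, `HypURangeN.nRange_1_100001`); the analytic chain and LEMMA S⁺ light are inside.
Composed in `TheoremUPlusFinal.thmUPlus`. -/
theorem thmUPlus_of_ranges (h1 : URange 2 30001) (h3r : URange3 3 100001) (hn : NRange 1 100001) :
    ThmUPlus :=
  thmUPlus_of (goodOddP_of_ranges h1 h3r hn)

/-- LEMMA W at every odd level from the three kernel ranges -/
theorem hypWPlus_of_ranges (h1 : URange 2 30001) (h3r : URange3 3 100001) (hn : NRange 1 100001) :
    HypWPlus :=
  hypWPlus_of (goodOddP_of_ranges h1 h3r hn)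

/-- the generation-25 statements (squarefree odd levels) are the special case `Squarefree N`. -/
theorem thmUOdd_of_thmUPlus (h : ThmUPlus) : ThmUOdd :=
  fun N a b c a' b' c' _ h2 h21 h39 => h N a b c a' b' c' h2 h21 h39

/-- the squarefree form of LEMMA W from the general one -/
theorem hypWOdd_of_hypWPlus (h : HypWPlus) : HypWOdd := fun N h1 _ h2 h21 h39 => h N h1 h2 h21 h39

end HodgeFermat.KRFree.HypUPlus

/-! ## (3/4) `HodgeFermat/HypUOddFinal.lean` — source lines 22–33 -/

set_option autoImplicit false

namespace HodgeFermat.KRFree.HypUOdd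

open HodgeFermat.KRFree.HypBReduction HodgeFermat.KRFree.HypUCert

export HodgeFermat.KRFree.OneFile (hypU)

/-- the levels divisible by `3`: walk below `100001`, tail beyond. -/
theorem good3 (N : ℕ) (hsq : Squarefree N) (h2 : ¬ 2 ∣ N) (h3 : 3 ∣ N) (h21 : N ≠ 21) (h39 : N ≠ 39) :
    Good N := good3_of_range3 uRange3_3_100001 N hsq h2 h3 h21 h39

/-- **LEMMA S** at every odd squarefree level `N > 1` other than `21, 39` — no hypotheses. -/
theorem goodOdd : GoodOdd := goodOdd_of_ranges HypUAuto.uRange_2_30001 uRange3_3_100001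

end HodgeFermat.KRFree.HypUOdd

/-! ## (4/4) `HodgeFermat/HypUPlusFinal.lean` — source lines 16–23 -/

set_option autoImplicit false

namespace HodgeFermat.KRFree.HypUPlus

/-- **LEMMA S⁺** (`U(N) < 1/6`) at every odd level `N > 1` other than `21, 39` — no hypotheses. -/
theorem goodOddP : GoodOddP := goodOddP_of HypUOdd.goodOdd nRange_1_100001

end HodgeFermat.KRFree.HypUPlus
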